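import Summits.CriticalPhenomena.Ising3DConformalLimit.Theses.EnergyNotSigmaSquared
import Summits.CriticalPhenomena.Ising3DConformalLimit.Theorems.GapForcesFarMerging.Negative.SoftShapes
import Literature.Probability.LatticeModels.SourcedDoubleCurrents
import Literature.Probability.LatticeModels.CurrentsSetConditioning
import Literature.Probability.LatticeModels.CurrentExplorationWeights
import HarnessLib

/-!
# Objects of the line `one-cluster-depletion-sandwich` for the crux `GapForcesFarMerging`
(item stmt-CriticalPhenomena-4468; route decl
`Summit.CriticalPhenomena.Ising3DConformalLimit.Theses.EnergyNotSigmaSquared.GapForcesFarMerging`)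

Route-posited objects (D-0016: the definitions a line posits live in a reviewed `…Defs` file, never
inside a proof file; precedents `EnergyNotSigmaSquaredRungOneAdjacentMergingDefs.lean`,
`EnergyNotSigmaSquaredGapForcesFarMergingScreeningDefs.lean`). The line (checked skeleton
`Cruxes/GapForcesFarMerging/Lines/one-cluster-depletion-sandwich.lean`, planner
`planner-cruxplan-stmt-CriticalPhenomena-4468-one-cluster-depletio-0`, lead seat c1
`prover-line-stmt-CriticalPhenomena-4468-c1-0`) puts hypothesis and conclusion of the crux on a pair of
INDEPENDENT DUPLICATED critical clusters `C_{n₁+n₂}(y₀)`, `C_{n₃+n₄}(y₂)` in the free box `Λ_n` of `ℤ³` at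
`β_c(3)` (ADC21 §3.1–3.2, the objects of (3.13) and of route item `RungOneAdjacentMerging`): GAP ⟹ (double
sandwich + RP un-pinching) the one-pinch duplicated avoidance `avoid n (pinch K)` decays as a power along
doubling octaves; a positive non-intersection exponent of two independent sets forces duplicated far hitting of
a dilated lattice shape (hazard domination + tail tightness + octave counting); duplicated far hitting ⟹ (fatness)
two-current far merging ⟹ (ADC21 (3.11) in the box + limits) `FarMerging`.

Contents (definitional bookkeeping only — the statements are byte-identical with the checked skeleton; every piece of
mathematics is in the stub files `Theorems/EnergyNotSigmaSquaredGapForcesFarMergingSandwich*.lean` importing this module):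
* lattice vocabulary `e₁ e₂ e₃`, `G = criticalTwoPoint 3`, `pairCov`, the one-pinch quadruple `pinch K = (0, p_K, e₂, q_K)`,
  the doubling window `Doubling θ K`;
* random-current vocabulary: `fourTraceLaw` (product of two `sourcedDoubleCurrentLaw`s), the events `Meet`, `MeetIn`,
  the probabilities `meet`, `avoid`, `avoidIn`, and the two-current `merge`;
* the currencies (statements composed by the registered stubs): `DoubleSandwich` (finite graphs), `OnePinchDecay`,
  `HazardDomination`, `TailTightness`, `FarHitIO`, `FarMergeIO`, `FarMerging` (= the crux's consequent verbatim,
  `farMerging_iff_negative`), plus the sanity lemmas `crux_iff`, `pinch_injective`.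

References: Aizenman–Duminil-Copin 2021 (arXiv:1912.07973) §3 (3.11), (3.13), Appendix A Lemma A.1, Cor. A.2, Prop. A.3,
§6.2; Aizenman 1982 Lemma 9.3 and Prop. 5.3; Lawler 1991 ch. 3–5; Panis arXiv:2406.15243 §5.
-/

noncomputable section

namespace Summit.CriticalPhenomena.Ising3DConformalLimit.GapForcesFarMergingSandwich

open scoped symmDiff ENNReal
open MeasureTheory Filter
open Literature.Probability.LatticeModels Literature.Probability.Percolation
open Summit.CriticalPhenomena.Ising3DConformalLimit.Theses.EnergyNotSigmaSquared

/-! ## Lattice vocabulary (all over existing declarations) -/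

/-- `e₁ = (1,0,0)`: direction of the RP mirror / of GAP's far point `2^K e₁`. [folklore] -/
abbrev e₁ : Site 3 := Pi.single 0 1
/-- `e₂ = (0,1,0)`: the bond direction of GAP (`ε₀ = σ₀σ_{e₂}`, route file `Pi.single 1 1`). [folklore] -/
abbrev e₂ : Site 3 := Pi.single 1 1
/-- `e₃ = (0,0,1)`: the transverse direction separating the two far ends. [folklore] -/
abbrev e₃ : Site 3 := Pi.single 2 1

/-- The critical two-point function `G(x) = ⟨σ₀σ_x⟩_{β_c(3)}`. [folklore] -/
abbrev G (x : Site 3) : ℝ := criticalTwoPoint 3 x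

/-- Truncated pair–pair correlation `⟨σ_aσ_b ; σ_cσ_d⟩_{β_c(3)}`. [folklore] -/
def pairCov (a b c d : Site 3) : ℝ :=
  criticalCorr 3 4 ![a, b, c, d] - criticalCorr 3 2 ![a, b] * criticalCorr 3 2 ![c, d]

/-- Far source `p_K = (2^K, 0, 2^K)` of the one-pinch configuration at octave `K`. [folklore] -/
def pFar (K : ℕ) : Site 3 := ((2 : ℤ) ^ K) • e₁ + ((2 : ℤ) ^ K) • e₃

/-- Far probe end `q_K = (2^K, 0, -2^K)` (`‖p_K - q_K‖ = 2^{K+1}`). [folklore] -/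
def qFar (K : ℕ) : Site 3 := ((2 : ℤ) ^ K) • e₁ - ((2 : ℤ) ^ K) • e₃

/-- The ONE-PINCH quadruple at octave `K`: duplicated cluster of the pair `(0, p_K)`, independent duplicated
cluster of the pair `(e₂, q_K)` — one adjacent pinch `(0, e₂)`, far ends un-pinched. It is the image of
GAP's double-pinch quadruple `(0, e₂, 2^K e₁, 2^K e₁ + e₂)` paired with `(2^K e₃, -2^K e₃)` under the site
mirror `u₀ ↦ 2^K - u₀`. [folklore] -/
def pinch (K : ℕ) : Fin 4 → Site 3 := ![0, pFar K, e₂, qFar K]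

/-- DOUBLING WINDOW at octave `K` with constant `θ`: `G(2^{j+1}e₁) ≥ θ·G(2^j e₁)` for the seven octaves
`|j - K| ≤ 3`. Since `∏_{j<J} G(2^{j+1}e₁)/G(2^j e₁) ≥ c·4^{-J}` (`criticalTwoPoint_bounds_holds`), for
`θ < 4^{-7}` infinitely many `K` carry a window (pigeonhole); with Messager–Miracle-Solé folding a window
makes all values of `G` on `Λ_{2^{K+3}} ∖ Λ_{2^{K-3}}` comparable within `θ^{O(1)}`. [cite: AizenmanDuminilCopinAnnals2021, Def. 5.11 (P1)] -/
def Doubling (θ : ℝ) (K : ℕ) : Prop :=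
  ∀ j : ℕ, K ≤ j + 3 → j ≤ K + 3 → θ * G (((2 : ℤ) ^ j) • e₁) ≤ G (((2 : ℤ) ^ (j + 1)) • e₁)

/-! ## Random-current vocabulary: two INDEPENDENT DUPLICATED clusters in the box `Λ_n` at `β_c(3)` -/

/-- `β_c(3)`. [folklore] -/
abbrev βc : ℝ := criticalBeta 3

/-- Law of the PAIR OF TRACES `((n₁+n₂)^, (n₃+n₄)^)` of two independent sourced double currents of the free
box graph `freeBoxGraph 3 n`, sources `(∂n₁,∂n₂) = ({y₀,y₁}, ∅)`, `(∂n₃,∂n₄) = ({y₂,y₃}, ∅)` — ADC21's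
`P^{y₀y₁, y₂y₃, ∅, ∅}` with the pairing `(n₁,n₂)`, `(n₃,n₄)`, read on the traces (tree
`sourcedDoubleCurrentLaw`; junk `0` while a source is outside the box, immaterial under `∀ᶠ n`/`∃ᶠ n`).
[cite: AizenmanDuminilCopinAnnals2021, §3.1–3.2, eq. (3.13)] -/
def fourTraceLaw (n : ℕ) (y : Fin 4 → Site 3) : Measure (BondConfig (Site 3) × BondConfig (Site 3)) :=
  (sourcedDoubleCurrentLaw 3 n βc ({y 0} ∆ {y 1}) ∅).prod (sourcedDoubleCurrentLaw 3 n βc ({y 2} ∆ {y 3}) ∅)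

/-- The two duplicated clusters `C_{n₁+n₂}(y₀)` and `C_{n₃+n₄}(y₂)` share a vertex. [cite: AizenmanDuminilCopinAnnals2021, eq. (3.13)] -/
def Meet (y : Fin 4 → Site 3) : Set (BondConfig (Site 3) × BondConfig (Site 3)) :=
  {ω | ∃ u : Site 3, u ∈ openCluster ω.1 (y 0) ∧ u ∈ openCluster ω.2 (y 2)}

/-- The two duplicated clusters share a vertex of the ball `Λ_R = box 3 R`. [folklore] -/
def MeetIn (R : ℕ) (y : Fin 4 → Site 3) : Set (BondConfig (Site 3) × BondConfig (Site 3)) :=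
  {ω | ∃ u ∈ box 3 R, u ∈ openCluster ω.1 (y 0) ∧ u ∈ openCluster ω.2 (y 2)}

/-- DUPLICATED HITTING probability `P^{y₀y₁,∅}⊗P^{y₂y₃,∅}_{Λ_n}[C_{n₁+n₂}(y₀) ∩ C_{n₃+n₄}(y₂) ≠ ∅]`. [cite: AizenmanDuminilCopinAnnals2021, eq. (3.13)] -/
def meet (n : ℕ) (y : Fin 4 → Site 3) : ℝ := (fourTraceLaw n y).real (Meet y)

/-- DUPLICATED AVOIDANCE probability (total): `P[C_{n₁+n₂}(y₀) ∩ C_{n₃+n₄}(y₂) = ∅]`. [folklore] -/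
def avoid (n : ℕ) (y : Fin 4 → Site 3) : ℝ := (fourTraceLaw n y).real (Meet y)ᶜ

/-- DUPLICATED AVOIDANCE INSIDE THE BALL `Λ_R`: `P[C_{n₁+n₂}(y₀) ∩ C_{n₃+n₄}(y₂) ∩ Λ_R = ∅]` (non-increasing
in `R`, equal to `avoid` once `Λ_R` contains the box). [folklore] -/
def avoidIn (n R : ℕ) (y : Fin 4 → Site 3) : ℝ := (fourTraceLaw n y).real (MeetIn R y)ᶜ

/-- TWO-CURRENT MERGING probability `P^{y₀y₁, y₂y₃}_{Λ_n}[y₀ ↔ y₂ in n₁+n₂]` (the event of ADC21 (3.11):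
`U₄ = -2⟨σσ⟩⟨σσ⟩·P[merge]`), read on the trace of `n₁+n₂`. [cite: AizenmanDuminilCopinAnnals2021, eq. (3.11)] -/
def merge (n : ℕ) (y : Fin 4 → Site 3) : ℝ :=
  (sourcedDoubleCurrentLaw 3 n βc ({y 0} ∆ {y 1}) ({y 2} ∆ {y 3})).real {ω | y 2 ∈ openCluster ω (y 0)}

/-! ## Currencies of the line -/

open Classical in
/-- **DOUBLE SANDWICH** (finite graph, couplings `K ≥ 0`, un-normalised current-sum form). For vertices
`o x a x'`: `∑ 1{∂n₁=ox}1{∂n₂=∅}1{∂n₃=ax'}1{∂n₄=∅} w⁴ 𝟙[C_{n₁+n₂}(o) ∩ C_{n₃+n₄}(a) = ∅]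
 ≤ Z[∅]² · ∑ 1{∂n₁=ox}1{∂n₃=ax'} w w 𝟙[a ∉ C_{n₁+n₃}(o)]`, i.e. after division by `Z[ox]Z[ax']Z[∅]²`:
`P^{ox,∅}⊗P^{ax',∅}[C_{n₁+n₂}(o) ∩ C_{n₃+n₄}(a) = ∅] ≤ P^{ox}⊗P^{ax'}[o ↮ a in n₁+n₃]`.
Proof sketch (all ingredients proved in tree): (A) Lemma A.1 with `W = {o}`, `B = {a,x'}`,
`F = 𝟙[a ∉ C_{n₁+n₂}(o)]` (`Current.tsum_epairWeight_eq_tsum_mul_offRatio_set`; parity gives `x' ∉ C`):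
rhs `= ∑ 1{ox}1{∅} w w 𝟙[a,x' ∉ C] · Z_{off C}[ax']/Z_{off C}[∅]`, `C = C_{n₁+n₂}(o)`; (B) for every vertex set
`C`: decompose `(n₃,n₄)` by `T = C_{n₃+n₄}(a)` (`Current.tsum_pair_eq_sum_cluster`), in the full and in the
`C`-depleted model (`koff` on the bonds meeting `C`), and compare the exterior factors with
`Z_{off(T∪C)}[∅]·Z[∅] ≥ Z_{off T}[∅]·Z_{off C}[∅]` (`Current.ecurrentSum_koff_union_mul_ge`), giving
`∑ 1{ax'}1{∅} w w 𝟙[C_{n₃+n₄}(a) ∩ C = ∅] ≤ Z_{off C}[ax'] Z[∅]²/Z_{off C}[∅]`; (A)+(B) and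
`a ∈ C_{n₃+n₄}(a)`. Sources: ADC21 App. A Lemma A.1 and (3.13)/Cor. A.2; Aizenman 1982 Lemma 9.3. Statement of the registered stub
`stub_doubleSandwich` (a finite-graph inequality posited by the line — route-posited currency, not a literature fact). -/
def DoubleSandwich : Prop :=
  ∀ (V : Type) [Fintype V] [DecidableEq V] (Γ : SimpleGraph V) [DecidableRel Γ.Adj]
    (K : Γ.edgeFinset → ℝ), (∀ ed, 0 ≤ K ed) → ∀ o x a x' : V,
    (∑' q : (Current Γ × Current Γ) × (Current Γ × Current Γ),
        epairWeight K ({o} ∆ {x}) ∅ q.1 * epairWeight K ({a} ∆ {x'}) ∅ q.2 *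
          (if Disjoint ((q.1.1 + q.1.2).cluster o) ((q.2.1 + q.2.2).cluster a) then 1 else 0))
      ≤ ecurrentSum K (∅ : Finset V) ^ 2 *
        ∑' p : Current Γ × Current Γ, epairWeight K ({o} ∆ {x}) ({a} ∆ {x'}) p *
          (if a ∉ (p.1 + p.2).cluster o then 1 else 0)

/-- (C1) ONE-PINCH DECAY: for some `κ' > 0`, along infinitely many doubling octaves `K`, eventually in the
box size, the two independent duplicated clusters of the one-pinch configuration avoid each other with
probability `≤ C·2^{-κ'K}` (predicted `κ' = κ/2 = Δ_ε - 2Δ_σ ≈ 0.376`). Conclusion of the registered stub `stub_onePinchDecay`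
(route-posited currency of the line, not a literature fact). -/
def OnePinchDecay : Prop :=
  ∃ κ C θ : ℝ, 0 < κ ∧ 0 < θ ∧ ∃ᶠ K : ℕ in atTop, Doubling θ K ∧
    ∀ᶠ n : ℕ in atTop, avoid n (pinch K) ≤ C * ((2 : ℝ) ^ K) ^ (-κ)

/-- (C2) HAZARD DOMINATION (per octave, by fresh dilated shapes). There are a shape box `M`, a lag `k₁`,
`C` and `ε_k → 0` such that for every octave `1 ≤ k ≤ K+3` of a doubling far octave `K`, eventually in `n`:
if every injective shape `y ∈ (Λ_M)⁴` dilated by `2^j`, `k-k₁ ≤ j ≤ k+2`, has duplicated hitting `≤ c`,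
then the conditional hazard of the one-pinch system across the annulus `Λ_{2^k} ∖ Λ_{2^{k-1}}`,
`1 - avoidIn(2^k)/avoidIn(2^{k-1})`, is `≤ C·c + ε_k`. Content = T1/T3's residual made explicit:
(S) separation of the two clusters' exit points on `∂Λ_{2^{k-1}}` given avoidance inside, (D) ONE-SET
comparability of each cluster's annulus piece, given its own inside, with a fresh sourced duplicated cluster
(domain Markov `Current.tsum_pair_eq_sum_clusterSet`, source insertion `Current.ecurrentSum_empty_mul_tsum_avoidSet_le`,
two-passage chain rule `BackboneChainRuleTwo`), (H) relocation of the four effective sources to lattice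
points of `2^{k-k₁}ℤ³` (two-point Harnack at a windowed scale; ADC21 Thm 5.12 / Panis arXiv:2406.15243 Thm 5.3),
and NO joint conditioning of a merged pair. Template: ADC21 §6.2 (6.11)–(6.13); Lawler 1991 ch. 3–5. Statement of the registered (open,
hardest) stub `stub_hazardDomination` (route-posited currency of the line, not a literature fact). -/
def HazardDomination : Prop :=
  ∀ θ : ℝ, 0 < θ → ∃ M k₁ : ℕ, ∃ C : ℝ, ∃ ε : ℕ → ℝ, Tendsto ε atTop (nhds 0) ∧
    ∀ k K : ℕ, 1 ≤ k → k ≤ K + 3 → Doubling θ K → ∀ᶠ n : ℕ in atTop, ∀ c : ℝ,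
      (∀ y : Fin 4 → Site 3, Function.Injective y → (∀ i, y i ∈ box 3 M) →
          ∀ j : ℕ, k ≤ j + k₁ → j ≤ k + 2 → meet n (fun i => ((2 : ℤ) ^ j) • y i) ≤ c) →
        avoidIn n (2 ^ (k - 1)) (pinch K) - avoidIn n (2 ^ k) (pinch K) ≤
          (C * c + ε k) * avoidIn n (2 ^ (k - 1)) (pinch K)

/-- (C3) TAIL TIGHTNESS: given that the two duplicated clusters of the one-pinch system at far octave `K`
avoid each other inside the ball `Λ_{2^{K+3}}` (which contains all four sources with margin `7·2^K`), they
avoid each other everywhere with conditional probability `≥ δ`, uniformly in doubling `K` and large `n`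
(both clusters would have to travel `≥ 7×` beyond their sources and meet out there). T3's named doubt:
annulus-crossing / re-entry tightness of a SOURCED duplicated cluster on `ℤ³` beyond its source scale, under
the avoidance tilt (ADC21 Lemma 6.2 is `d = 4`; in `d = 3` crossing bounds are ADS15-qualitative; first
moments are useless here since `E|C ∩ Ann_R| ≍ R·2^K` diverges). Template: ADC21 Lemma 6.2; Panis arXiv:2406.15243 §5. Statement of the
registered (open) stub `stub_tailTightness` (route-posited currency of the line, not a literature fact). -/
def TailTightness : Prop :=
  ∀ θ : ℝ, 0 < θ → ∃ δ : ℝ, 0 < δ ∧ ∀ K : ℕ, Doubling θ K →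
    ∀ᶠ n : ℕ in atTop, δ * avoidIn n (2 ^ (K + 3)) (pinch K) ≤ avoid n (pinch K)

/-- (C4) FAR DUPLICATED HITTING, INFINITELY OFTEN: some injective lattice quadruple `y` and `c > 0` such
that along infinitely many dilations `L`, frequently in the box size, the independent duplicated clusters
`C_{n₁+n₂}(Ly₀)` (pair `Ly₀,Ly₁`) and `C_{n₃+n₄}(Ly₂)` (pair `Ly₂,Ly₃`) meet with probability `≥ c` (the objects of ADC21 (3.13)).
Conclusion of the registered stub `stub_octaveCounting` (route-posited currency of the line, not a literature fact). -/
def FarHitIO : Prop :=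
  ∃ c : ℝ, 0 < c ∧ ∃ y : Fin 4 → Site 3, Function.Injective y ∧ ∀ L₀ : ℕ, ∃ L : ℕ, L₀ ≤ L ∧
    ∃ᶠ n : ℕ in atTop, c ≤ meet n (fun i => (L : ℤ) • y i)

/-- (C5) FAR TWO-CURRENT MERGING, INFINITELY OFTEN: the same with the merging event of ADC21 (3.11),
`P^{Ly₀Ly₁, Ly₂Ly₃}_{Λ_n}[Ly₀ ↔ Ly₂ in n₁+n₂] ≥ c'` (the event of ADC21 (3.11)). Conclusion of the registered stub
`stub_fourToTwoMerging` (route-posited currency of the line, not a literature fact). -/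
def FarMergeIO : Prop :=
  ∃ c : ℝ, 0 < c ∧ ∃ y : Fin 4 → Site 3, Function.Injective y ∧ ∀ L₀ : ℕ, ∃ L : ℕ, L₀ ≤ L ∧
    ∃ᶠ n : ℕ in atTop, c ≤ merge n (fun i => (L : ℤ) • y i)

/-- The conclusion of the crux, verbatim (= `Negative.FarMergingShape Negative.cc2 (criticalCorr 3 4)`, `farMerging_iff_negative`;
the consequent of the route decl `GapForcesFarMerging`, restated only so that the stubs compose by name — not a literature fact). -/
def FarMerging : Prop :=
  ∃ c : ℝ, 0 < c ∧ ∃ x : Fin 4 → Site 3, Function.Injective x ∧ ∀ L₀ : ℕ, ∃ L : ℕ, L₀ ≤ L ∧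
    criticalCorr 3 4 (fun i => (L : ℤ) • x i) -
      (criticalCorr 3 2 ![(L : ℤ) • x 0, (L : ℤ) • x 1] * criticalCorr 3 2 ![(L : ℤ) • x 2, (L : ℤ) • x 3] +
       criticalCorr 3 2 ![(L : ℤ) • x 0, (L : ℤ) • x 2] * criticalCorr 3 2 ![(L : ℤ) • x 1, (L : ℤ) • x 3] +
       criticalCorr 3 2 ![(L : ℤ) • x 0, (L : ℤ) • x 3] * criticalCorr 3 2 ![(L : ℤ) • x 1, (L : ℤ) • x 2])
      ≤ -(c * (criticalCorr 3 2 ![(L : ℤ) • x 0, (L : ℤ) • x 1] * criticalCorr 3 2 ![(L : ℤ) • x 2, (L : ℤ) • x 3]))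

/-- The crux is literally `EnergyGapPowerLaw → FarMerging`. [folklore] -/
theorem crux_iff :
    Summit.CriticalPhenomena.Ising3DConformalLimit.Theses.EnergyNotSigmaSquared.GapForcesFarMerging ↔
      (EnergyGapPowerLaw → FarMerging) := Iff.rfl

/-- `FarMerging` is the landed Negative file's `FarMergingShape` of the critical correlators. [folklore] -/
theorem farMerging_iff_negative :
    FarMerging ↔ Theorems.GapForcesFarMerging.Negative.FarMergingShape
      Theorems.GapForcesFarMerging.Negative.cc2 (criticalCorr 3 4) := Iff.rfl

/-- Coordinates of the far ends (bookkeeping for `pinch_injective`). [folklore] -/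
@[simp] theorem pFar_apply_zero (K : ℕ) : pFar K 0 = 2 ^ K := by simp [pFar]
/-- Coordinates of the far ends. [folklore] -/
@[simp] theorem pFar_apply_two (K : ℕ) : pFar K 2 = 2 ^ K := by simp [pFar]
/-- Coordinates of the far ends. [folklore] -/
@[simp] theorem qFar_apply_zero (K : ℕ) : qFar K 0 = 2 ^ K := by simp [qFar]
/-- Coordinates of the far ends. [folklore] -/
@[simp] theorem qFar_apply_two (K : ℕ) : qFar K 2 = -2 ^ K := by simp [qFar]

/-- The one-pinch quadruple is injective (a legitimate four-source configuration; in particular all source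
sets `{y₀} ∆ {y₁}`, `{y₂} ∆ {y₃}` are genuine pairs). [folklore] -/
theorem pinch_injective (K : ℕ) : Function.Injective (pinch K) := by
  have h2 : (0 : ℤ) < 2 ^ K := pow_pos (by norm_num) K
  intro i j h
  have h0 := congrFun h 0
  have h1 := congrFun h 1
  have h3 := congrFun h 2
  fin_cases i <;> fin_cases j <;> simp [pinch, pFar, qFar] at h0 h1 h3 ⊢ <;> omega

/-! ## Reshape of the lead (seat c1, cycle 1, 2026-08-16): the tail debt dissolved into the hazard stub

Wave 1 landed S1 (`stub_doubleSandwich`, p100398), S2 (`stub_onePinchDecay`, p104198), S5 (`stub_octaveCounting`,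
p105714, with the near-pinch floor `nearPinchFloor` p103345) and S7 (`stub_farMergingSpins`, p99692), and PROVED the far
tail of S4 by first moment (`tailTightness_farTail`, p105708: beyond radius `R` the two duplicated clusters meet with
probability `≤ C·16^K/(R+1)`), leaving of `TailTightness` exactly its middle range `2^{K+3} … 2^{5K+3}` (no engine on `ℤ³`:
a tilt-robust one-arm / clumping bound for a SOURCED duplicated cluster beyond its source scale). The reshape below keeps the
composition of the line and the far-end debt (S6) unchanged and moves that middle range into the hazard stub: the per-octave
domination is asked for every octave `1 ≤ k ≤ 5K+3` (not only `k ≤ K+3`), and the tail currency becomes the landed far tail.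
-/

/-- (C2′) HAZARD DOMINATION OVER ALL OCTAVES `1 ≤ k ≤ 5K+3` (reshape of `HazardDomination`, whose range stopped at the
source octaves `k ≤ K+3`): the same per-octave domination of the conditional hazard of the one-pinch system across
`Λ_{2^k} ∖ Λ_{2^{k-1}}` by fresh duplicated hittings of dilated lattice shapes at comparable scale, now also at the
octaves beyond the far ends — where its content is the tilt-robust excursion control that `TailTightness` isolated (two
duplicated clusters that avoided each other inside `Λ_{2^{k-1}}`, `2^k ≫ 2^K`, rarely both travel to the annulus and meet
there unless fresh fat shapes at that scale meet). Statement of the registered (open, hardest) stub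
`stub_hazardDominationExt` (route-posited currency of the line, not a literature fact). -/
def HazardDominationExt : Prop :=
  ∀ θ : ℝ, 0 < θ → ∃ M k₁ : ℕ, ∃ C : ℝ, ∃ ε : ℕ → ℝ, Tendsto ε atTop (nhds 0) ∧
    ∀ k K : ℕ, 1 ≤ k → k ≤ 5 * K + 3 → Doubling θ K → ∀ᶠ n : ℕ in atTop, ∀ c : ℝ,
      (∀ y : Fin 4 → Site 3, Function.Injective y → (∀ i, y i ∈ box 3 M) →
          ∀ j : ℕ, k ≤ j + k₁ → j ≤ k + 2 → meet n (fun i => ((2 : ℤ) ^ j) • y i) ≤ c) →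
        avoidIn n (2 ^ (k - 1)) (pinch K) - avoidIn n (2 ^ k) (pinch K) ≤
          (C * c + ε k) * avoidIn n (2 ^ (k - 1)) (pinch K)

/-- (C3′) FAR TAIL (reshape of `TailTightness`; a THEOREM: `tailTightness_farTail`, p105708, first moment with the exact
one-point density `G_n(a,v)G_n(v,b)/G_n(a,b)` and the tree's two-point bounds): beyond radius `R` the two duplicated
clusters of the one-pinch system at octave `K` meet with probability at most `C·16^K/(R+1)`, eventually in the box size,
uniformly in `R`. Statement of the registered stub `stub_farTail` (route-posited currency of the line, not a literature fact). -/
def FarTail : Prop :=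
  ∃ C : ℝ, ∀ K : ℕ, ∀ᶠ n : ℕ in atTop, ∀ R : ℕ,
    avoidIn n R (pinch K) - avoid n (pinch K) ≤ C * 16 ^ K / (R + 1)

/-- The extended hazard domination restricts to the planner's range `k ≤ K + 3`. [folklore] -/
theorem hazardDomination_of_ext (h : HazardDominationExt) : HazardDomination := by
  intro θ hθ
  obtain ⟨M, k₁, C, ε, hε, hdom⟩ := h θ hθ
  exact ⟨M, k₁, C, ε, hε, fun k K hk hkK hD => hdom k K hk (by omega) hD⟩

/-! ## Split of the hazard stub (lead seat c1, cycle 1): un-conditioning × meet domination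

`HazardDominationExt` is the conjunction of two different difficulties, separated here so that each can be attacked (and
refuted) on its own: (AD) AVOIDANCE DOMINATION — conditioning on the decreasing event "the two duplicated clusters avoided
each other inside `Λ_{2^{k-1}}`" does not inflate the probability of the increasing event "they share a vertex of the annulus
`Λ_{2^k} ∖ Λ_{2^{k-1}}`" by more than a constant (an FKG-shaped one-sided inequality for a product of two non-FKG laws;
reroot-avoidance-domination card, K1); and (MD) MEET DOMINATION — the UNconditional annulus-meeting probability of the
one-pinch system is dominated by fresh duplicated hittings of dilated lattice shapes at comparable scale (same-point
re-rooting `P[meet_k] = Σ_v a₁(v)a₂(v)·E^{rr(v)}[1/N_k]` is exact, ADC21 §4.1; the comparison of the re-rooted local count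
with fresh shapes is the (D)+(H) content). `hazardDominationExt_of_AD_MD` below composes them.
-/

/-- The two duplicated clusters share a vertex of the ANNULUS `Λ_{2^k} ∖ Λ_{2^{k-1}}` (`box 3 (2^k) \ box 3 (2^(k-1))`). [folklore] -/
def MeetAnn (k : ℕ) (y : Fin 4 → Site 3) : Set (BondConfig (Site 3) × BondConfig (Site 3)) :=
  {ω | ∃ u ∈ box 3 (2 ^ k) \ box 3 (2 ^ (k - 1)), u ∈ openCluster ω.1 (y 0) ∧ u ∈ openCluster ω.2 (y 2)}

/-- UNCONDITIONAL ANNULUS-MEETING probability of the one-pinch system at far octave `K`, octave `k`: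
`P[C_{n₁+n₂}(0) ∩ C_{n₃+n₄}(e₂) ∩ (Λ_{2^k} ∖ Λ_{2^{k-1}}) ≠ ∅]`. [folklore] -/
def meetAnn (n k K : ℕ) : ℝ := (fourTraceLaw n (pinch K)).real (MeetAnn k (pinch K))

/-- (AD) AVOIDANCE DOMINATION (un-conditioning): for every octave `1 ≤ k ≤ 5K+3` of a doubling far octave `K`,
eventually in `n`, `P[avoid inside Λ_{2^{k-1}} ∧ meet inside Λ_{2^k}] ≤ (C·P[meet in the annulus k] + ε_k)·P[avoid inside Λ_{2^{k-1}}]`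
— conditioning on inner avoidance inflates annulus meeting by at most a constant (plus `ε_k → 0`). FKG-shaped; random
currents are not FKG (loop O(1) is even negatively associated), so this is a genuine one-sided domination statement for the
specific pair (inner avoidance ↓, annulus meeting ↑) of a product of two independent sourced duplicated clusters. Statement of
the registered (open) stub `stub_avoidanceDomination` (route-posited currency of the line, not a literature fact). -/
def AvoidanceDomination : Prop :=
  ∀ θ : ℝ, 0 < θ → ∃ C : ℝ, ∃ ε : ℕ → ℝ, Tendsto ε atTop (nhds 0) ∧
    ∀ k K : ℕ, 1 ≤ k → k ≤ 5 * K + 3 → Doubling θ K → ∀ᶠ n : ℕ in atTop,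
      avoidIn n (2 ^ (k - 1)) (pinch K) - avoidIn n (2 ^ k) (pinch K) ≤
        (C * meetAnn n k K + ε k) * avoidIn n (2 ^ (k - 1)) (pinch K)

/-- (MD) MEET DOMINATION (un-tilted relocation): for every octave `1 ≤ k ≤ 5K+3` of a doubling far octave `K`, eventually
in `n`: if every injective shape `y ∈ (Λ_M)⁴` dilated by `2^j`, `k-k₁ ≤ j ≤ k+2`, has duplicated hitting `≤ c`, then the
UNCONDITIONAL annulus-meeting probability of the one-pinch system is `≤ C·c + ε_k`. Content: same-point re-rooting of both
clusters at a common vertex of the annulus (exact, switching lemma) + comparison of the re-rooted local intersection count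
with that of fresh dilated shapes ((D) one-set un-tilting of the inner strands, (H) source relocation at a windowed scale);
at octaves beyond the far ends (`k > K+3`) it is the excursion control formerly in `TailTightness`. Statement of the
registered (open) stub `stub_meetDomination` (route-posited currency of the line, not a literature fact). -/
def MeetDomination : Prop :=
  ∀ θ : ℝ, 0 < θ → ∃ M k₁ : ℕ, ∃ C : ℝ, ∃ ε : ℕ → ℝ, Tendsto ε atTop (nhds 0) ∧
    ∀ k K : ℕ, 1 ≤ k → k ≤ 5 * K + 3 → Doubling θ K → ∀ᶠ n : ℕ in atTop, ∀ c : ℝ,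
      (∀ y : Fin 4 → Site 3, Function.Injective y → (∀ i, y i ∈ box 3 M) →
          ∀ j : ℕ, k ≤ j + k₁ → j ≤ k + 2 → meet n (fun i => ((2 : ℤ) ^ j) • y i) ≤ c) →
        meetAnn n k K ≤ C * c + ε k

/-- `avoidIn` is a probability of the four-trace law, hence `≥ 0`. [folklore] -/
theorem avoidIn_nonneg (n R : ℕ) (y : Fin 4 → Site 3) : 0 ≤ avoidIn n R y := measureReal_nonneg

/-- **(AD) ∧ (MD) ⟹ hazard domination over all octaves** (constants `C₁C₂`, errors `C₁⁺ε² + ε¹ → 0`). [folklore] -/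
theorem hazardDominationExt_of_AD_MD (hAD : AvoidanceDomination) (hMD : MeetDomination) : HazardDominationExt := by
  intro θ hθ
  obtain ⟨C₁, ε₁, hε₁, had⟩ := hAD θ hθ
  obtain ⟨M, k₁, C₂, ε₂, hε₂, hmd⟩ := hMD θ hθ
  refine ⟨M, k₁, max C₁ 0 * C₂, fun k => max C₁ 0 * ε₂ k + ε₁ k, ?_, ?_⟩
  · simpa using (hε₂.const_mul (max C₁ 0)).add hε₁
  · intro k K hk hkK hD
    filter_upwards [had k K hk hkK hD, hmd k K hk hkK hD] with n hn hm
    intro c hc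
    have hA : 0 ≤ avoidIn n (2 ^ (k - 1)) (pinch K) := avoidIn_nonneg _ _ _
    have hmeet : meetAnn n k K ≤ C₂ * c + ε₂ k := hm c hc
    have hC₁ : C₁ ≤ max C₁ 0 := le_max_left _ _
    have h0 : 0 ≤ max C₁ 0 := le_max_right _ _
    have hmn : 0 ≤ meetAnn n k K := measureReal_nonneg
    calc avoidIn n (2 ^ (k - 1)) (pinch K) - avoidIn n (2 ^ k) (pinch K)
        ≤ (C₁ * meetAnn n k K + ε₁ k) * avoidIn n (2 ^ (k - 1)) (pinch K) := hn
      _ ≤ (max C₁ 0 * meetAnn n k K + ε₁ k) * avoidIn n (2 ^ (k - 1)) (pinch K) := by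
          apply mul_le_mul_of_nonneg_right _ hA
          nlinarith
      _ ≤ (max C₁ 0 * (C₂ * c + ε₂ k) + ε₁ k) * avoidIn n (2 ^ (k - 1)) (pinch K) := by
          apply mul_le_mul_of_nonneg_right _ hA
          nlinarith [mul_le_mul_of_nonneg_left hmeet h0]
      _ = (max C₁ 0 * C₂ * c + (max C₁ 0 * ε₂ k + ε₁ k)) * avoidIn n (2 ^ (k - 1)) (pinch K) := by ring

end Summit.CriticalPhenomena.Ising3DConformalLimit.GapForcesFarMergingSandwich

end
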